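import Literature.MathematicalPhysics.QuantumManyBody.BoseEinsteinCondensation
import Mathlib.MeasureTheory.Integral.Bochner.Basic
import HarnessLib

/-!
# Positivity of the Conlon–Lieb–Yau kernel in Fourier space

Topic `Literature/MathematicalPhysics/QuantumManyBody` (electrostatics groundwork for the charged
Bose gas, `JelliumBoseGas.foldyLaw`). [ConlonLiebYau1988, Lemma 2.1], as quoted in
[LiebSolovej2001, §3]: for `K(z) = r⁻¹(e^{-νr} - e^{-ωr}h(z))`, `h` even, `C⁴`, compactly
supported with `h(0) = 1`, there is `C₃(h)` such that `K` has a positive Fourier transform once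
`ω - ν ≥ C₃`. In Fourier space (`𝓕(e^{-ω|·|}/|·|)(p) = 4π/(4π²|p|² + ω²)`, `YukawaFourier.lean`, and
`𝓕(hY_ω) = ĥ ∗ 𝓕Y_ω`) the claim is the inequality

**`∫ ĥ(q) · 4π/(4π²|p - q|² + m) dq ≤ 4π/(4π²|p|² + n)`**, `m = ω²`, `n = ν²`,

for a real even `ĥ =: η` with `∫η = 1` and enough moments. This file proves it, with explicit
constants, by the argument: `∫η = 1` and evenness reduce the left side to
`4π/(4π²|p|²+m) + ∫ η(q) Rem_p(q) dq`, where `Rem_p(q)` is the second-order Taylor remainder of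
the symbol `ξ ↦ 4π/(4π²|ξ|² + m)` at `p` (the linear term integrates to zero against the even
`η`); an exact algebraic formula for `Rem_p(q)` gives
`|Rem_p(q)| ≤ 16π³(6|q|² + 4π²|q|⁴/m)/((4π²|p|²+m)(4π²|p-q|²+m))`, and
`1/(4π²|p-q|²+m) ≤ 4/(4π²|p|²+m) + (1+4|q|²)²/(m(1+|p|²)²)` (cases `|q| ≤ |p|/2` or not); the
resulting error is `≤ 4π(m-n)/((4π²|p|²+m)(4π²|p|²+n)) = 4π/(4π²|p|²+n) - 4π/(4π²|p|²+m)` as soon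
as `m ≥ 4π²` and `m - n ≥ 16π² max(2A, B)`, `A = ∫(6|q|²+4π²|q|⁴)|η|`,
`B = ∫(6|q|²+4π²|q|⁴)(1+4|q|²)²|η|`.

* `Coulomb.yukawaSymbol_taylor` — the exact formula for `Rem_p(q)`.
* `Coulomb.abs_yukawaSymbol_remainder_le`, `inv_yukawaDen_le`, `abs_yukawaSymbol_remainder_le'` —
  the remainder bounds.
* `Coulomb.integral_even_mul_inner_eq_zero` — the linear term vanishes.
* `Coulomb.cly_taylor_decomposition` — `∫η(q)4π/(4π²|p-q|²+m)dq = 4π/(4π²|p|²+m) + ∫Rem_p η` with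
  the quantitative bound `|∫ Rem_p η| ≤ 16π³(4A/C² + B/(C m (1+|p|²)²))`, `C = 4π²|p|² + m`.
* `Coulomb.cly_fourier_positivity` — **the inequality**.

## References

* [ConlonLiebYau1988] J. G. Conlon, E. H. Lieb, H.-T. Yau, *The N^{7/5} law for charged bosons*,
  Commun. Math. Phys. 116 (1988) 417–448, Lemma 2.1.
* [LiebSolovej2001] E. H. Lieb, J. P. Solovej, Commun. Math. Phys. 217 (2001) 127–163, §3
  (arXiv:cond-mat/0007425, p. 8).
-/

noncomputable section

open MeasureTheory Set Filter Real
open scoped ENNReal NNReal Topology InnerProductSpace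

namespace Literature.MathematicalPhysics.QuantumManyBody.Coulomb

open BoseGas

/-! ### The second-order expansion of the Yukawa symbol -/

/-- **Exact second-order Taylor formula for the Yukawa symbol** `ξ ↦ 4π/(4π²|ξ|² + m)` at `p`,
increment `-q`: with `C = 4π²|p|² + m`, `D = 4π²|p - q|² + m`,
`4π/D - 4π/C - 32π³⟨p,q⟩/C² = 16π³(-|q|²C + 16π²⟨p,q⟩² - 8π²|q|²⟨p,q⟩)/(C²D)`. [folklore] -/
theorem yukawaSymbol_taylor {m : ℝ} (hm : 0 < m) (p q : Space) :
    4 * π / (4 * π ^ 2 * ‖p - q‖ ^ 2 + m) - 4 * π / (4 * π ^ 2 * ‖p‖ ^ 2 + m) -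
        32 * π ^ 3 * ⟪p, q⟫_ℝ / (4 * π ^ 2 * ‖p‖ ^ 2 + m) ^ 2 =
      16 * π ^ 3 * (-(‖q‖ ^ 2 * (4 * π ^ 2 * ‖p‖ ^ 2 + m)) + 16 * π ^ 2 * ⟪p, q⟫_ℝ ^ 2 -
          8 * π ^ 2 * ‖q‖ ^ 2 * ⟪p, q⟫_ℝ) /
        ((4 * π ^ 2 * ‖p‖ ^ 2 + m) ^ 2 * (4 * π ^ 2 * ‖p - q‖ ^ 2 + m)) := by
  have e : ‖p - q‖ ^ 2 = ‖p‖ ^ 2 - 2 * ⟪p, q⟫_ℝ + ‖q‖ ^ 2 := norm_sub_sq_real p q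
  have hC : 0 < 4 * π ^ 2 * ‖p‖ ^ 2 + m := by positivity
  have hD : 0 < 4 * π ^ 2 * ‖p - q‖ ^ 2 + m := by positivity
  rw [e] at hD ⊢
  field_simp
  ring

/-- **Remainder bound**: `|Rem_p(q)| ≤ 16π³(6|q|² + 4π²|q|⁴/m)/(C·D)` (`16π²⟨p,q⟩² ≤ 4|q|²C`,
`8π²|q|²|⟨p,q⟩| ≤ |q|²(4π²|p|²) + 4π²|q|⁴ ≤ |q|²C + (4π²|q|⁴/m)C`). [folklore] -/
theorem abs_yukawaSymbol_remainder_le {m : ℝ} (hm : 0 < m) (p q : Space) :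
    |4 * π / (4 * π ^ 2 * ‖p - q‖ ^ 2 + m) - 4 * π / (4 * π ^ 2 * ‖p‖ ^ 2 + m) -
        32 * π ^ 3 * ⟪p, q⟫_ℝ / (4 * π ^ 2 * ‖p‖ ^ 2 + m) ^ 2| ≤
      16 * π ^ 3 * (6 * ‖q‖ ^ 2 + 4 * π ^ 2 * ‖q‖ ^ 4 / m) /
        ((4 * π ^ 2 * ‖p‖ ^ 2 + m) * (4 * π ^ 2 * ‖p - q‖ ^ 2 + m)) := by
  rw [yukawaSymbol_taylor hm]
  have hC : 0 < 4 * π ^ 2 * ‖p‖ ^ 2 + m := by positivity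
  have hD : 0 < 4 * π ^ 2 * ‖p - q‖ ^ 2 + m := by positivity
  have hπ : 0 < π := Real.pi_pos
  -- bound on the numerator
  have hb : |⟪p, q⟫_ℝ| ≤ ‖p‖ * ‖q‖ := abs_real_inner_le_norm p q
  have hnum : |-(‖q‖ ^ 2 * (4 * π ^ 2 * ‖p‖ ^ 2 + m)) + 16 * π ^ 2 * ⟪p, q⟫_ℝ ^ 2 -
      8 * π ^ 2 * ‖q‖ ^ 2 * ⟪p, q⟫_ℝ| ≤
      (6 * ‖q‖ ^ 2 + 4 * π ^ 2 * ‖q‖ ^ 4 / m) * (4 * π ^ 2 * ‖p‖ ^ 2 + m) := by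
    have h1 : ⟪p, q⟫_ℝ ^ 2 ≤ ‖p‖ ^ 2 * ‖q‖ ^ 2 := by
      rw [← mul_pow, ← sq_abs]
      exact pow_le_pow_left₀ (abs_nonneg _) hb 2
    have h2 : |⟪p, q⟫_ℝ| * ‖q‖ ^ 2 ≤ ‖p‖ * ‖q‖ * ‖q‖ ^ 2 :=
      mul_le_mul_of_nonneg_right hb (by positivity)
    -- `2 (2π|p|)(2π|q|) ≤ 4π²|p|² + 4π²|q|²`
    have h3 : 8 * π ^ 2 * (‖p‖ * ‖q‖) ≤ 4 * π ^ 2 * ‖p‖ ^ 2 + 4 * π ^ 2 * ‖q‖ ^ 2 := by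
      nlinarith [sq_nonneg (‖p‖ - ‖q‖)]
    have h4 : 4 * π ^ 2 * ‖q‖ ^ 4 ≤ 4 * π ^ 2 * ‖q‖ ^ 4 / m * (4 * π ^ 2 * ‖p‖ ^ 2 + m) := by
      rw [div_mul_eq_mul_div, le_div_iff₀ hm]
      have : m ≤ 4 * π ^ 2 * ‖p‖ ^ 2 + m := by nlinarith [sq_nonneg (π * ‖p‖)]
      exact mul_le_mul_of_nonneg_left this (by positivity)
    refine (abs_sub _ _).trans ((add_le_add (abs_add_le _ _) le_rfl).trans ?_)
    rw [abs_neg, abs_of_nonneg (by positivity : 0 ≤ ‖q‖ ^ 2 * (4 * π ^ 2 * ‖p‖ ^ 2 + m)),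
      abs_of_nonneg (by positivity : 0 ≤ 16 * π ^ 2 * ⟪p, q⟫_ℝ ^ 2), abs_mul, abs_mul,
      abs_of_nonneg (by positivity : 0 ≤ 8 * π ^ 2), abs_of_nonneg (by positivity : 0 ≤ ‖q‖ ^ 2)]
    have hq2 : 0 ≤ ‖q‖ ^ 2 := by positivity
    nlinarith [h1, h2, h3, h4, mul_le_mul_of_nonneg_left h3 hq2, hq2,
      mul_nonneg hq2 (sq_nonneg ‖p‖)]
  rw [abs_div, abs_mul, abs_of_pos (by positivity : (0:ℝ) < 16 * π ^ 3),
    abs_of_pos (by positivity : (0:ℝ) < (4 * π ^ 2 * ‖p‖ ^ 2 + m) ^ 2 * (4 * π ^ 2 * ‖p - q‖ ^ 2 + m)),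
    div_le_div_iff₀ (by positivity) (by positivity)]
  have := mul_le_mul_of_nonneg_left hnum (by positivity : (0:ℝ) ≤ 16 * π ^ 3)
  nlinarith [this, hC, hD, mul_pos hC hD, mul_pos (mul_pos hC hC) hD]

/-- **The shifted denominator**: `1/(4π²|p-q|²+m) ≤ 4/(4π²|p|²+m) + (1+4|q|²)²/(m(1+|p|²)²)`
(if `|q| ≤ |p|/2` then `|p - q| ≥ |p|/2`; otherwise `1 + |p|² ≤ 1 + 4|q|²`). [folklore] -/
theorem inv_yukawaDen_le {m : ℝ} (hm : 0 < m) (p q : Space) :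
    1 / (4 * π ^ 2 * ‖p - q‖ ^ 2 + m) ≤
      4 / (4 * π ^ 2 * ‖p‖ ^ 2 + m) + (1 + 4 * ‖q‖ ^ 2) ^ 2 / (m * (1 + ‖p‖ ^ 2) ^ 2) := by
  have hC : 0 < 4 * π ^ 2 * ‖p‖ ^ 2 + m := by positivity
  have hD : 0 < 4 * π ^ 2 * ‖p - q‖ ^ 2 + m := by positivity
  have h2nn : 0 ≤ (1 + 4 * ‖q‖ ^ 2) ^ 2 / (m * (1 + ‖p‖ ^ 2) ^ 2) := by positivity
  have h1nn : 0 ≤ 4 / (4 * π ^ 2 * ‖p‖ ^ 2 + m) := by positivity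
  by_cases hq : 2 * ‖q‖ ≤ ‖p‖
  · -- `|p - q| ≥ |p|/2`, so `D ≥ C/4`
    have hpq : ‖p‖ / 2 ≤ ‖p - q‖ := by
      have := norm_sub_norm_le p q
      have h' : ‖p‖ - ‖q‖ ≤ ‖p - q‖ := by linarith [norm_sub_norm_le p q]
      linarith
    have hpq2 : ‖p‖ ^ 2 / 4 ≤ ‖p - q‖ ^ 2 := by
      have h0 : 0 ≤ ‖p‖ / 2 := by positivity
      nlinarith [pow_le_pow_left₀ h0 hpq 2]
    have hDC : (4 * π ^ 2 * ‖p‖ ^ 2 + m) / 4 ≤ 4 * π ^ 2 * ‖p - q‖ ^ 2 + m := by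
      nlinarith [hpq2, Real.pi_pos, hm]
    calc 1 / (4 * π ^ 2 * ‖p - q‖ ^ 2 + m) ≤ 1 / ((4 * π ^ 2 * ‖p‖ ^ 2 + m) / 4) :=
          one_div_le_one_div_of_le (by positivity) hDC
      _ = 4 / (4 * π ^ 2 * ‖p‖ ^ 2 + m) := by field_simp
      _ ≤ _ := le_add_of_nonneg_right h2nn
  · -- `|p| < 2|q|`, so `(1+4|q|²)/(1+|p|²) ≥ 1` and `D ≥ m`
    push Not at hq
    have hr : 1 ≤ (1 + 4 * ‖q‖ ^ 2) ^ 2 / (1 + ‖p‖ ^ 2) ^ 2 := by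
      rw [le_div_iff₀ (by positivity), one_mul]
      have : 1 + ‖p‖ ^ 2 ≤ 1 + 4 * ‖q‖ ^ 2 := by nlinarith [norm_nonneg p, norm_nonneg q]
      exact pow_le_pow_left₀ (by positivity) this 2
    calc 1 / (4 * π ^ 2 * ‖p - q‖ ^ 2 + m) ≤ 1 / m :=
          one_div_le_one_div_of_le hm (by nlinarith [sq_nonneg (π * ‖p - q‖)])
      _ ≤ 1 / m * ((1 + 4 * ‖q‖ ^ 2) ^ 2 / (1 + ‖p‖ ^ 2) ^ 2) :=
          le_mul_of_one_le_right (by positivity) hr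
      _ = (1 + 4 * ‖q‖ ^ 2) ^ 2 / (m * (1 + ‖p‖ ^ 2) ^ 2) := by
          field_simp
      _ ≤ _ := le_add_of_nonneg_left h1nn

/-- **Pointwise remainder bound, global form**:
`|Rem_p(q)| ≤ 16π³(6|q|² + 4π²|q|⁴/m)(4/C² + (1+4|q|²)²/(C m (1+|p|²)²))`, `C = 4π²|p|² + m`.
[folklore] -/
theorem abs_yukawaSymbol_remainder_le' {m : ℝ} (hm : 0 < m) (p q : Space) :
    |4 * π / (4 * π ^ 2 * ‖p - q‖ ^ 2 + m) - 4 * π / (4 * π ^ 2 * ‖p‖ ^ 2 + m) -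
        32 * π ^ 3 * ⟪p, q⟫_ℝ / (4 * π ^ 2 * ‖p‖ ^ 2 + m) ^ 2| ≤
      16 * π ^ 3 * (6 * ‖q‖ ^ 2 + 4 * π ^ 2 * ‖q‖ ^ 4 / m) *
        (4 / (4 * π ^ 2 * ‖p‖ ^ 2 + m) ^ 2 +
          (1 + 4 * ‖q‖ ^ 2) ^ 2 / ((4 * π ^ 2 * ‖p‖ ^ 2 + m) * m * (1 + ‖p‖ ^ 2) ^ 2)) := by
  have hC : 0 < 4 * π ^ 2 * ‖p‖ ^ 2 + m := by positivity
  have hD : 0 < 4 * π ^ 2 * ‖p - q‖ ^ 2 + m := by positivity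
  refine (abs_yukawaSymbol_remainder_le hm p q).trans ?_
  have hE : 0 ≤ 16 * π ^ 3 * (6 * ‖q‖ ^ 2 + 4 * π ^ 2 * ‖q‖ ^ 4 / m) := by positivity
  have hinv := inv_yukawaDen_le hm p q
  calc 16 * π ^ 3 * (6 * ‖q‖ ^ 2 + 4 * π ^ 2 * ‖q‖ ^ 4 / m) /
        ((4 * π ^ 2 * ‖p‖ ^ 2 + m) * (4 * π ^ 2 * ‖p - q‖ ^ 2 + m))
      = 16 * π ^ 3 * (6 * ‖q‖ ^ 2 + 4 * π ^ 2 * ‖q‖ ^ 4 / m) *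
          ((1 / (4 * π ^ 2 * ‖p‖ ^ 2 + m)) * (1 / (4 * π ^ 2 * ‖p - q‖ ^ 2 + m))) := by
        field_simp
    _ ≤ 16 * π ^ 3 * (6 * ‖q‖ ^ 2 + 4 * π ^ 2 * ‖q‖ ^ 4 / m) *
          ((1 / (4 * π ^ 2 * ‖p‖ ^ 2 + m)) * (4 / (4 * π ^ 2 * ‖p‖ ^ 2 + m) +
            (1 + 4 * ‖q‖ ^ 2) ^ 2 / (m * (1 + ‖p‖ ^ 2) ^ 2))) :=
        mul_le_mul_of_nonneg_left (mul_le_mul_of_nonneg_left hinv (by positivity)) hE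
    _ = _ := by
        field_simp

/-! ### The linear term integrates to zero -/

/-- For an even `η` the odd moment `∫ η(q)⟨p, q⟩ dq` vanishes (no integrability needed).
[folklore] -/
theorem integral_even_mul_inner_eq_zero {η : Space → ℝ} (heven : ∀ q, η (-q) = η q) (p : Space) :
    ∫ q : Space, η q * ⟪p, q⟫_ℝ = 0 := by
  have h : ∫ q : Space, η q * ⟪p, q⟫_ℝ = -∫ q : Space, η q * ⟪p, q⟫_ℝ := by
    conv_lhs => rw [← integral_neg_eq_self]
    rw [← integral_neg]
    refine integral_congr_ae (Eventually.of_forall fun q => ?_)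
    simp only [heven, inner_neg_right]
    ring
  linarith

/-! ### Weighted integrability -/

/-- A weight `|w| ≤ c(1+|q|²)⁴` times `η` is integrable when `(1+|q|²)⁴η` is. [folklore] -/
theorem integrable_weight_mul {η : Space → ℝ} (hηm : Measurable η)
    (hint : Integrable fun q : Space => (1 + ‖q‖ ^ 2) ^ 4 * η q) {w : Space → ℝ}
    (hw : Measurable w) (c : ℝ) (hwc : ∀ q, |w q| ≤ c * (1 + ‖q‖ ^ 2) ^ 4) :
    Integrable fun q : Space => w q * η q := by
  refine (hint.norm.const_mul c).mono' (hw.mul hηm).aestronglyMeasurable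
    (Eventually.of_forall fun q => ?_)
  rw [Real.norm_eq_abs, abs_mul, Real.norm_eq_abs, abs_mul,
    abs_of_nonneg (by positivity : (0:ℝ) ≤ (1 + ‖q‖ ^ 2) ^ 4), ← mul_assoc]
  exact mul_le_mul_of_nonneg_right (hwc q) (abs_nonneg _)

/-- `|q|^k ≤ (1+|q|²)^4` for the small powers used below. [folklore] -/
theorem norm_pow_le_weight (q : Space) :
    ‖q‖ ≤ (1 + ‖q‖ ^ 2) ^ 4 ∧ ‖q‖ ^ 2 ≤ (1 + ‖q‖ ^ 2) ^ 4 ∧ ‖q‖ ^ 4 ≤ (1 + ‖q‖ ^ 2) ^ 4 ∧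
      ‖q‖ ^ 2 * (1 + 4 * ‖q‖ ^ 2) ^ 2 ≤ 16 * (1 + ‖q‖ ^ 2) ^ 4 ∧
      ‖q‖ ^ 4 * (1 + 4 * ‖q‖ ^ 2) ^ 2 ≤ 16 * (1 + ‖q‖ ^ 2) ^ 4 := by
  have h0 : 0 ≤ ‖q‖ := norm_nonneg q
  have h1 : 1 ≤ 1 + ‖q‖ ^ 2 := by nlinarith
  have h1' : ‖q‖ ≤ 1 + ‖q‖ ^ 2 := by nlinarith [sq_nonneg (‖q‖ - 1)]
  have h2 : ‖q‖ ^ 2 ≤ 1 + ‖q‖ ^ 2 := by linarith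
  have hp2 : (1 + ‖q‖ ^ 2) ≤ (1 + ‖q‖ ^ 2) ^ 4 := by
    calc (1 + ‖q‖ ^ 2) = (1 + ‖q‖ ^ 2) ^ 1 := (pow_one _).symm
      _ ≤ (1 + ‖q‖ ^ 2) ^ 4 := pow_le_pow_right₀ h1 (by norm_num)
  have hp22 : (1 + ‖q‖ ^ 2) ^ 2 ≤ (1 + ‖q‖ ^ 2) ^ 4 := pow_le_pow_right₀ h1 (by norm_num)
  have h4 : ‖q‖ ^ 4 ≤ (1 + ‖q‖ ^ 2) ^ 2 := by nlinarith
  have h14 : (1 + 4 * ‖q‖ ^ 2) ≤ 4 * (1 + ‖q‖ ^ 2) := by nlinarith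
  have h14sq : (1 + 4 * ‖q‖ ^ 2) ^ 2 ≤ 16 * (1 + ‖q‖ ^ 2) ^ 2 := by nlinarith
  refine ⟨h1'.trans hp2, h2.trans hp2, h4.trans hp22, ?_, ?_⟩
  · calc ‖q‖ ^ 2 * (1 + 4 * ‖q‖ ^ 2) ^ 2 ≤ (1 + ‖q‖ ^ 2) ^ 2 * (16 * (1 + ‖q‖ ^ 2) ^ 2) := by
          apply mul_le_mul (by nlinarith) h14sq (by positivity) (by positivity)
      _ = 16 * (1 + ‖q‖ ^ 2) ^ 4 := by ring
  · calc ‖q‖ ^ 4 * (1 + 4 * ‖q‖ ^ 2) ^ 2 ≤ (1 + ‖q‖ ^ 2) ^ 2 * (16 * (1 + ‖q‖ ^ 2) ^ 2) := by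
          apply mul_le_mul h4 h14sq (by positivity) (by positivity)
      _ = 16 * (1 + ‖q‖ ^ 2) ^ 4 := by ring

/-! ### The inequality -/

/-- **Second-order decomposition of `η ∗ 𝓕Y`** [ConlonLiebYau1988, Lemma 2.1 (proof)]: for
`η` measurable, even, `∫η = 1`, `(1+|q|²)⁴η ∈ L¹` and `m ≥ 1`,
`∫ η(q) 4π/(4π²|p-q|²+m) dq = 4π/(4π²|p|²+m) + ∫ Rem_p(q) η(q) dq` (the linear Taylor term drops by
evenness) with `|∫ Rem_p η| ≤ 16π³(4/C²)A + 16π³B/(C m (1+|p|²)²)`, `C = 4π²|p|² + m`,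
`A = ∫(6|q|²+4π²|q|⁴)|η|`, `B = ∫(6|q|²+4π²|q|⁴)(1+4|q|²)²|η|`. [cite: ConlonLiebYau1988, Lemma 2.1] -/
theorem cly_taylor_decomposition {η : Space → ℝ} (hηm : Measurable η) (heven : ∀ q, η (-q) = η q)
    (hη1 : ∫ q, η q = 1) (hint : Integrable fun q : Space => (1 + ‖q‖ ^ 2) ^ 4 * η q)
    {m : ℝ} (hm1 : 1 ≤ m) (p : Space) :
    (∫ q, η q * (4 * π / (4 * π ^ 2 * ‖p - q‖ ^ 2 + m)) =
      4 * π / (4 * π ^ 2 * ‖p‖ ^ 2 + m) +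
        ∫ q, (4 * π / (4 * π ^ 2 * ‖p - q‖ ^ 2 + m) - 4 * π / (4 * π ^ 2 * ‖p‖ ^ 2 + m) -
          32 * π ^ 3 * ⟪p, q⟫_ℝ / (4 * π ^ 2 * ‖p‖ ^ 2 + m) ^ 2) * η q) ∧
    |∫ q, (4 * π / (4 * π ^ 2 * ‖p - q‖ ^ 2 + m) - 4 * π / (4 * π ^ 2 * ‖p‖ ^ 2 + m) -
          32 * π ^ 3 * ⟪p, q⟫_ℝ / (4 * π ^ 2 * ‖p‖ ^ 2 + m) ^ 2) * η q| ≤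
      16 * π ^ 3 * (4 / (4 * π ^ 2 * ‖p‖ ^ 2 + m) ^ 2) *
          (∫ q, (6 * ‖q‖ ^ 2 + 4 * π ^ 2 * ‖q‖ ^ 4) * |η q|) +
        16 * π ^ 3 / ((4 * π ^ 2 * ‖p‖ ^ 2 + m) * m * (1 + ‖p‖ ^ 2) ^ 2) *
          (∫ q, (6 * ‖q‖ ^ 2 + 4 * π ^ 2 * ‖q‖ ^ 4) * (1 + 4 * ‖q‖ ^ 2) ^ 2 * |η q|) := by
  have hπ : 0 < π := Real.pi_pos
  have hm0 : 0 < m := by linarith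
  have hC : 0 < 4 * π ^ 2 * ‖p‖ ^ 2 + m := by positivity
  have hw := norm_pow_le_weight
  -- measurability / integrability of the pieces
  have hηabs : Measurable fun q => |η q| := continuous_abs.measurable.comp hηm
  have hintabs : Integrable fun q : Space => (1 + ‖q‖ ^ 2) ^ 4 * |η q| := by
    refine hint.abs.congr (Eventually.of_forall fun q => ?_)
    simp only [abs_mul, abs_of_nonneg (by positivity : (0:ℝ) ≤ (1 + ‖q‖ ^ 2) ^ 4)]
  have hinner : Measurable fun q : Space => ⟪p, q⟫_ℝ := (continuous_const.inner continuous_id).measurable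
  have hIη : Integrable η := by
    have h := integrable_weight_mul hηm hint measurable_const 1 (w := fun _ => (1:ℝ))
      (fun q => by rw [abs_one, one_mul]; exact one_le_pow₀ (by nlinarith [norm_nonneg q]))
    simpa using h
  have hIlin : Integrable fun q : Space => ⟪p, q⟫_ℝ * η q :=
    integrable_weight_mul hηm hint hinner ‖p‖
      (fun q => (abs_real_inner_le_norm p q).trans
        (mul_le_mul_of_nonneg_left (hw q).1 (norm_nonneg _)))
  have hwA : Measurable fun q : Space => 6 * ‖q‖ ^ 2 + 4 * π ^ 2 * ‖q‖ ^ 4 :=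
    (measurable_const.mul (measurable_norm.pow_const _)).add
      (measurable_const.mul (measurable_norm.pow_const _))
  have hwB : Measurable fun q : Space => (6 * ‖q‖ ^ 2 + 4 * π ^ 2 * ‖q‖ ^ 4) * (1 + 4 * ‖q‖ ^ 2) ^ 2 :=
    hwA.mul (((measurable_const.mul (measurable_norm.pow_const _)).const_add _).pow_const _)
  have hwA_le : ∀ q : Space, 6 * ‖q‖ ^ 2 + 4 * π ^ 2 * ‖q‖ ^ 4 ≤ (6 + 4 * π ^ 2) * (1 + ‖q‖ ^ 2) ^ 4 := by
    intro q
    have h4 := mul_le_mul_of_nonneg_left (hw q).2.2.1 (by positivity : (0:ℝ) ≤ 4 * π ^ 2)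
    nlinarith [(hw q).2.1, h4]
  have hwB_le : ∀ q : Space, (6 * ‖q‖ ^ 2 + 4 * π ^ 2 * ‖q‖ ^ 4) * (1 + 4 * ‖q‖ ^ 2) ^ 2 ≤
      (6 + 4 * π ^ 2) * 16 * (1 + ‖q‖ ^ 2) ^ 4 := by
    intro q
    have h4 := mul_le_mul_of_nonneg_left (hw q).2.2.2.2 (by positivity : (0:ℝ) ≤ 4 * π ^ 2)
    nlinarith [(hw q).2.2.2.1, h4]
  have hIA : Integrable fun q : Space => (6 * ‖q‖ ^ 2 + 4 * π ^ 2 * ‖q‖ ^ 4) * |η q| :=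
    integrable_weight_mul hηabs hintabs hwA (6 + 4 * π ^ 2)
      (fun q => by rw [abs_of_nonneg (by positivity)]; exact hwA_le q)
  have hIB : Integrable fun q : Space =>
      (6 * ‖q‖ ^ 2 + 4 * π ^ 2 * ‖q‖ ^ 4) * (1 + 4 * ‖q‖ ^ 2) ^ 2 * |η q| :=
    integrable_weight_mul hηabs hintabs hwB ((6 + 4 * π ^ 2) * 16)
      (fun q => by rw [abs_of_nonneg (by positivity)]; exact hwB_le q)
  -- the remainder and its bound
  set Rm : Space → ℝ := fun q => 4 * π / (4 * π ^ 2 * ‖p - q‖ ^ 2 + m) -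
    4 * π / (4 * π ^ 2 * ‖p‖ ^ 2 + m) - 32 * π ^ 3 * ⟪p, q⟫_ℝ / (4 * π ^ 2 * ‖p‖ ^ 2 + m) ^ 2
    with hRm
  set bd : Space → ℝ := fun q => 16 * π ^ 3 * (6 * ‖q‖ ^ 2 + 4 * π ^ 2 * ‖q‖ ^ 4) *
    (4 / (4 * π ^ 2 * ‖p‖ ^ 2 + m) ^ 2 +
      (1 + 4 * ‖q‖ ^ 2) ^ 2 / ((4 * π ^ 2 * ‖p‖ ^ 2 + m) * m * (1 + ‖p‖ ^ 2) ^ 2)) with hbd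
  have hRm_le : ∀ q, |Rm q| ≤ bd q := by
    intro q
    refine (abs_yukawaSymbol_remainder_le' hm0 p q).trans ?_
    simp only [hbd]
    refine mul_le_mul_of_nonneg_right (mul_le_mul_of_nonneg_left ?_ (by positivity)) (by positivity)
    have : 4 * π ^ 2 * ‖q‖ ^ 4 / m ≤ 4 * π ^ 2 * ‖q‖ ^ 4 := div_le_self (by positivity) hm1
    linarith
  have hRm_meas : Measurable Rm := by
    simp only [hRm]
    exact ((measurable_const.div ((measurable_const.mul
      ((measurable_const.sub measurable_id).norm.pow_const _)).add_const _)).sub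
        measurable_const).sub ((measurable_const.mul hinner).div measurable_const)
  -- `bd = c₁ w_A + c₂ w_B`
  have hbd_eq : ∀ q, bd q = 16 * π ^ 3 * (4 / (4 * π ^ 2 * ‖p‖ ^ 2 + m) ^ 2) *
        (6 * ‖q‖ ^ 2 + 4 * π ^ 2 * ‖q‖ ^ 4) +
      16 * π ^ 3 / ((4 * π ^ 2 * ‖p‖ ^ 2 + m) * m * (1 + ‖p‖ ^ 2) ^ 2) *
        ((6 * ‖q‖ ^ 2 + 4 * π ^ 2 * ‖q‖ ^ 4) * (1 + 4 * ‖q‖ ^ 2) ^ 2) := by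
    intro q
    simp only [hbd]
    ring
  have hbd_meas : Measurable bd := by
    have : bd = fun q => 16 * π ^ 3 * (4 / (4 * π ^ 2 * ‖p‖ ^ 2 + m) ^ 2) *
        (6 * ‖q‖ ^ 2 + 4 * π ^ 2 * ‖q‖ ^ 4) +
      16 * π ^ 3 / ((4 * π ^ 2 * ‖p‖ ^ 2 + m) * m * (1 + ‖p‖ ^ 2) ^ 2) *
        ((6 * ‖q‖ ^ 2 + 4 * π ^ 2 * ‖q‖ ^ 4) * (1 + 4 * ‖q‖ ^ 2) ^ 2) := funext hbd_eq
    rw [this]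
    exact (measurable_const.mul hwA).add (measurable_const.mul hwB)
  have hbd_le : ∀ q, |bd q| ≤ (16 * π ^ 3 * (4 / (4 * π ^ 2 * ‖p‖ ^ 2 + m) ^ 2) * (6 + 4 * π ^ 2) +
      16 * π ^ 3 / ((4 * π ^ 2 * ‖p‖ ^ 2 + m) * m * (1 + ‖p‖ ^ 2) ^ 2) * ((6 + 4 * π ^ 2) * 16)) *
      (1 + ‖q‖ ^ 2) ^ 4 := by
    intro q
    have hbd0 : 0 ≤ bd q := by simp only [hbd]; positivity
    rw [abs_of_nonneg hbd0, hbd_eq q]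
    have e1 := mul_le_mul_of_nonneg_left (hwA_le q)
      (by positivity : (0:ℝ) ≤ 16 * π ^ 3 * (4 / (4 * π ^ 2 * ‖p‖ ^ 2 + m) ^ 2))
    have e2 := mul_le_mul_of_nonneg_left (hwB_le q)
      (by positivity : (0:ℝ) ≤ 16 * π ^ 3 / ((4 * π ^ 2 * ‖p‖ ^ 2 + m) * m * (1 + ‖p‖ ^ 2) ^ 2))
    calc _ ≤ 16 * π ^ 3 * (4 / (4 * π ^ 2 * ‖p‖ ^ 2 + m) ^ 2) * ((6 + 4 * π ^ 2) * (1 + ‖q‖ ^ 2) ^ 4) +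
          16 * π ^ 3 / ((4 * π ^ 2 * ‖p‖ ^ 2 + m) * m * (1 + ‖p‖ ^ 2) ^ 2) *
            ((6 + 4 * π ^ 2) * 16 * (1 + ‖q‖ ^ 2) ^ 4) := add_le_add e1 e2
      _ = _ := by ring
  have hIRm : Integrable fun q : Space => Rm q * η q :=
    integrable_weight_mul hηm hint hRm_meas _
      (fun q => (hRm_le q).trans ((le_abs_self _).trans (hbd_le q)))
  have hIbd : Integrable fun q : Space => bd q * |η q| :=
    integrable_weight_mul hηabs hintabs hbd_meas _ hbd_le
  -- Step 1: decomposition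
  have hdec : ∫ q, η q * (4 * π / (4 * π ^ 2 * ‖p - q‖ ^ 2 + m)) =
      4 * π / (4 * π ^ 2 * ‖p‖ ^ 2 + m) + ∫ q, Rm q * η q := by
    have e : (fun q => η q * (4 * π / (4 * π ^ 2 * ‖p - q‖ ^ 2 + m))) = fun q =>
        (4 * π / (4 * π ^ 2 * ‖p‖ ^ 2 + m) * η q +
          32 * π ^ 3 / (4 * π ^ 2 * ‖p‖ ^ 2 + m) ^ 2 * (⟪p, q⟫_ℝ * η q)) + Rm q * η q := by
      funext q
      simp only [hRm]
      ring
    have hI12 : Integrable fun q : Space => 4 * π / (4 * π ^ 2 * ‖p‖ ^ 2 + m) * η q +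
        32 * π ^ 3 / (4 * π ^ 2 * ‖p‖ ^ 2 + m) ^ 2 * (⟪p, q⟫_ℝ * η q) :=
      (hIη.const_mul _).add (hIlin.const_mul _)
    rw [e, integral_add hI12 hIRm, integral_add (hIη.const_mul _) (hIlin.const_mul _),
      integral_const_mul, integral_const_mul, hη1, mul_one]
    have h0 : ∫ q : Space, ⟪p, q⟫_ℝ * η q = 0 := by
      have := integral_even_mul_inner_eq_zero heven p
      simpa [mul_comm] using this
    rw [h0, mul_zero, add_zero]
  refine ⟨hdec, ?_⟩
  have habs : |∫ q, Rm q * η q| ≤ ∫ q, bd q * |η q| := by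
    refine (abs_integral_le_integral_abs).trans (integral_mono hIRm.abs hIbd fun q => ?_)
    rw [abs_mul]
    exact mul_le_mul_of_nonneg_right (hRm_le q) (abs_nonneg _)
  refine habs.trans (le_of_eq ?_)
  have e : (fun q => bd q * |η q|) = fun q =>
      16 * π ^ 3 * (4 / (4 * π ^ 2 * ‖p‖ ^ 2 + m) ^ 2) *
          ((6 * ‖q‖ ^ 2 + 4 * π ^ 2 * ‖q‖ ^ 4) * |η q|) +
        16 * π ^ 3 / ((4 * π ^ 2 * ‖p‖ ^ 2 + m) * m * (1 + ‖p‖ ^ 2) ^ 2) *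
          ((6 * ‖q‖ ^ 2 + 4 * π ^ 2 * ‖q‖ ^ 4) * (1 + 4 * ‖q‖ ^ 2) ^ 2 * |η q|) := by
    funext q
    rw [hbd_eq q]
    ring
  rw [e, integral_add (hIA.const_mul _) (hIB.const_mul _), integral_const_mul, integral_const_mul]

/-- **Positivity of the CLY kernel in Fourier space** [ConlonLiebYau1988, Lemma 2.1 (Fourier
side)]: let `η : ℝ³ → ℝ` be measurable and even with `∫ η = 1` and `(1+|q|²)⁴η ∈ L¹` (think
`η = ĥ`, `h` even, smooth, compactly supported, `h(0) = 1`), and put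
`A = ∫(6|q|² + 4π²|q|⁴)|η|`, `B = ∫(6|q|² + 4π²|q|⁴)(1 + 4|q|²)²|η|`. If `m ≥ 4π²` and
`m - n ≥ 32π²A`, `m - n ≥ 16π²B`, then for every `p` with `4π²|p|² + n > 0`,
`∫ η(q) · 4π/(4π²|p - q|² + m) dq ≤ 4π/(4π²|p|² + n)`, i.e.
`𝓕(Y_ν - hY_ω)(p) ≥ 0` with `m = ω²`, `n = ν²`. [cite: ConlonLiebYau1988, Lemma 2.1] -/
theorem cly_fourier_positivity {η : Space → ℝ} (hηm : Measurable η) (heven : ∀ q, η (-q) = η q)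
    (hη1 : ∫ q, η q = 1) (hint : Integrable fun q : Space => (1 + ‖q‖ ^ 2) ^ 4 * η q)
    {m n : ℝ} (hm : 4 * π ^ 2 ≤ m)
    (hA : 32 * π ^ 2 * ∫ q, (6 * ‖q‖ ^ 2 + 4 * π ^ 2 * ‖q‖ ^ 4) * |η q| ≤ m - n)
    (hB : 16 * π ^ 2 * ∫ q, (6 * ‖q‖ ^ 2 + 4 * π ^ 2 * ‖q‖ ^ 4) * (1 + 4 * ‖q‖ ^ 2) ^ 2 * |η q| ≤
      m - n)
    (p : Space) (hp : 0 < 4 * π ^ 2 * ‖p‖ ^ 2 + n) :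
    ∫ q, η q * (4 * π / (4 * π ^ 2 * ‖p - q‖ ^ 2 + m)) ≤ 4 * π / (4 * π ^ 2 * ‖p‖ ^ 2 + n) := by
  have hπ : 0 < π := Real.pi_pos
  have hπ2 : 2 ≤ π := Real.two_le_pi
  have hm1 : 1 ≤ m := by nlinarith
  have hm0 : 0 < m := by linarith
  have hC : 0 < 4 * π ^ 2 * ‖p‖ ^ 2 + m := by positivity
  have hAnn : 0 ≤ ∫ q, (6 * ‖q‖ ^ 2 + 4 * π ^ 2 * ‖q‖ ^ 4) * |η q| :=
    integral_nonneg fun q => by positivity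
  have hBnn : 0 ≤ ∫ q, (6 * ‖q‖ ^ 2 + 4 * π ^ 2 * ‖q‖ ^ 4) * (1 + 4 * ‖q‖ ^ 2) ^ 2 * |η q| :=
    integral_nonneg fun q => by positivity
  have hnm : n ≤ m := by nlinarith
  obtain ⟨hdec, hremabs⟩ := cly_taylor_decomposition hηm heven hη1 hint hm1 p
  set Rm : Space → ℝ := fun q => 4 * π / (4 * π ^ 2 * ‖p - q‖ ^ 2 + m) -
    4 * π / (4 * π ^ 2 * ‖p‖ ^ 2 + m) - 32 * π ^ 3 * ⟪p, q⟫_ℝ / (4 * π ^ 2 * ‖p‖ ^ 2 + m) ^ 2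
    with hRm
  have hrem := (le_abs_self _).trans hremabs
  -- Step 3: the two error terms against `2π(m-n)/(C C')` each
  set A := ∫ q, (6 * ‖q‖ ^ 2 + 4 * π ^ 2 * ‖q‖ ^ 4) * |η q| with hAdef
  set B := ∫ q, (6 * ‖q‖ ^ 2 + 4 * π ^ 2 * ‖q‖ ^ 4) * (1 + 4 * ‖q‖ ^ 2) ^ 2 * |η q| with hBdef
  have hCC' : 4 * π ^ 2 * ‖p‖ ^ 2 + n ≤ 4 * π ^ 2 * ‖p‖ ^ 2 + m := by linarith
  have hmn0 : 0 ≤ m - n := sub_nonneg.2 hnm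
  have hea : 16 * π ^ 3 * (4 / (4 * π ^ 2 * ‖p‖ ^ 2 + m) ^ 2) * A ≤
      2 * π * (m - n) / ((4 * π ^ 2 * ‖p‖ ^ 2 + m) * (4 * π ^ 2 * ‖p‖ ^ 2 + n)) := by
    rw [show 16 * π ^ 3 * (4 / (4 * π ^ 2 * ‖p‖ ^ 2 + m) ^ 2) * A =
      64 * π ^ 3 * A / ((4 * π ^ 2 * ‖p‖ ^ 2 + m) * (4 * π ^ 2 * ‖p‖ ^ 2 + m)) by ring,
      div_le_div_iff₀ (by positivity) (by positivity)]
    have h1 : 64 * π ^ 3 * A ≤ 2 * π * (m - n) := by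
      have := mul_le_mul_of_nonneg_left hA (by positivity : (0:ℝ) ≤ 2 * π)
      linarith only [this]
    exact mul_le_mul h1 (mul_le_mul_of_nonneg_left hCC' hC.le) (by positivity) (by positivity)
  have heb : 16 * π ^ 3 / ((4 * π ^ 2 * ‖p‖ ^ 2 + m) * m * (1 + ‖p‖ ^ 2) ^ 2) * B ≤
      2 * π * (m - n) / ((4 * π ^ 2 * ‖p‖ ^ 2 + m) * (4 * π ^ 2 * ‖p‖ ^ 2 + n)) := by
    rw [div_mul_eq_mul_div, div_le_div_iff₀ (by positivity) (by positivity)]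
    -- `C' ≤ C ≤ m (1+|p|²)²`
    have hW1 : 1 ≤ 1 + ‖p‖ ^ 2 := by nlinarith [norm_nonneg p]
    have hCm : 4 * π ^ 2 * ‖p‖ ^ 2 + m ≤ m * (1 + ‖p‖ ^ 2) ^ 2 := by
      have h1 : 4 * π ^ 2 * ‖p‖ ^ 2 ≤ m * ‖p‖ ^ 2 := mul_le_mul_of_nonneg_right hm (by positivity)
      have hW2 : (1 + ‖p‖ ^ 2) ≤ (1 + ‖p‖ ^ 2) ^ 2 := by nlinarith [hW1]
      have h2 : m * (1 + ‖p‖ ^ 2) ≤ m * (1 + ‖p‖ ^ 2) ^ 2 := mul_le_mul_of_nonneg_left hW2 hm0.le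
      linarith only [h1, h2]
    have h1 : 16 * π ^ 3 * B ≤ π * (m - n) := by
      have := mul_le_mul_of_nonneg_left hB hπ.le
      linarith only [this]
    have hCC'2 : (4 * π ^ 2 * ‖p‖ ^ 2 + m) * (4 * π ^ 2 * ‖p‖ ^ 2 + n) ≤
        (4 * π ^ 2 * ‖p‖ ^ 2 + m) * (m * (1 + ‖p‖ ^ 2) ^ 2) :=
      mul_le_mul_of_nonneg_left (hCC'.trans hCm) hC.le
    have hπmn : 0 ≤ π * (m - n) := mul_nonneg hπ.le hmn0
    have hprod : 0 ≤ (4 * π ^ 2 * ‖p‖ ^ 2 + m) * (4 * π ^ 2 * ‖p‖ ^ 2 + n) := by positivity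
    have step1 : 16 * π ^ 3 * B * ((4 * π ^ 2 * ‖p‖ ^ 2 + m) * (4 * π ^ 2 * ‖p‖ ^ 2 + n)) ≤
        π * (m - n) * ((4 * π ^ 2 * ‖p‖ ^ 2 + m) * (m * (1 + ‖p‖ ^ 2) ^ 2)) :=
      mul_le_mul h1 hCC'2 hprod hπmn
    have h0 : 0 ≤ π * (m - n) * ((4 * π ^ 2 * ‖p‖ ^ 2 + m) * (m * (1 + ‖p‖ ^ 2) ^ 2)) :=
      mul_nonneg hπmn (by positivity)
    have e : π * (m - n) * ((4 * π ^ 2 * ‖p‖ ^ 2 + m) * (m * (1 + ‖p‖ ^ 2) ^ 2)) =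
        π * (m - n) * ((4 * π ^ 2 * ‖p‖ ^ 2 + m) * m * (1 + ‖p‖ ^ 2) ^ 2) := by ring
    rw [e] at step1 h0
    linarith only [step1, h0]
  -- Step 4: conclusion
  have hkey : 4 * π / (4 * π ^ 2 * ‖p‖ ^ 2 + m) +
      (2 * π * (m - n) / ((4 * π ^ 2 * ‖p‖ ^ 2 + m) * (4 * π ^ 2 * ‖p‖ ^ 2 + n)) +
        2 * π * (m - n) / ((4 * π ^ 2 * ‖p‖ ^ 2 + m) * (4 * π ^ 2 * ‖p‖ ^ 2 + n))) =
      4 * π / (4 * π ^ 2 * ‖p‖ ^ 2 + n) := by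
    field_simp
    ring
  have hfin : 4 * π / (4 * π ^ 2 * ‖p‖ ^ 2 + m) + ∫ q, Rm q * η q ≤
      4 * π / (4 * π ^ 2 * ‖p‖ ^ 2 + m) +
      (2 * π * (m - n) / ((4 * π ^ 2 * ‖p‖ ^ 2 + m) * (4 * π ^ 2 * ‖p‖ ^ 2 + n)) +
        2 * π * (m - n) / ((4 * π ^ 2 * ‖p‖ ^ 2 + m) * (4 * π ^ 2 * ‖p‖ ^ 2 + n))) := by
    linarith only [hrem, hea, heb]
  calc ∫ q, η q * (4 * π / (4 * π ^ 2 * ‖p - q‖ ^ 2 + m))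
      = 4 * π / (4 * π ^ 2 * ‖p‖ ^ 2 + m) + ∫ q, Rm q * η q := hdec
    _ ≤ _ := hfin
    _ = 4 * π / (4 * π ^ 2 * ‖p‖ ^ 2 + n) := hkey

end Literature.MathematicalPhysics.QuantumManyBody.Coulomb
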